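import Mathlib
import Summits.KontsevichZagierPeriods.Zeta5Search.RecordRayDominanceProof
import Summits.KontsevichZagierPeriods.Zeta5Search.MinorTermwiseBounds
import Summits.KontsevichZagierPeriods.Zeta5Search.BigPrimeWindow
import Summits.KontsevichZagierPeriods.Zeta5Search.ValuationLawsAboveB0
import HarnessLib

/-!
# ζ(5) search — (QV) and (P̂V) on the WHOLE Brown–Zudilin RECORD ray `b(n) = n·(41; 17,…,11)`, every direction `j`, all `n`

Cell `pub-zeta5` (HONEST FRAMING: systematic search; no irrationality claim unless certified), TRACK «DENOM-LAW» D1 prover seat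
(denom-prover-d1 g12, `HOME/denom-law/prover-d1/ATTEMPT-12.md` §8).  The record-ray twin of `FlagRayMinorsAll`: gen-2 g5's OBSERVED laws
`QMinorValuationLaw` (`v_p(U W⁺ − U⁺ W) ≥ refund − N_p`) and `PhatMinorValuationLaw` (`v_p(U V⁺ − U⁺ V) ≥ refund − 1 − N_p`) hold on the record ray
for every `n ≥ 1`, every `1 ≤ j ≤ 7`, every prime `p ≥ 5` with `p² > 41n + 2`, TERMWISE (`MinorTermwiseBounds`: `‖U‖ ≤ p^{−min(0,5+m)}`,
`‖W‖ ≤ p^{−min(0,3+m)}`, `‖V‖ ≤ p^{−VB}`, also for `b + e_j`) from the record ray's LANDED class data: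
* `p ≤ 12n`: counting — the interval certificate `rrd_table` (`RecordRayDominanceMid`) on `173n < 35p`, the linear counts below;
* `12n < p < 14n`: every class `E ≥ −5` (`RecordRayMid14.classExp_ge_neg5`); `14n < p < 15n`: cell A (`CellA.data_minAll` / `notMin_bounds`:
  `ν ≥ −4`, multipole `E ≥ −4`); `15n < p < 16n`: `Cell1516.classNu_ge16` / `classExp_ge16` (`≥ −3`); `16n < p ≤ 41n`: `RecordRayTop.multipole_bound`
  (`E ≥ −2`), `classNu_bound` (`ν ≥ −2 / −1 / 0`); `p > 41n`: `ValuationLawsAboveB0`;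
* the one cell where (QV) asks a unit, `18n < p ≤ 25n` (`refund = 1`, `N_p = 0`): the landed `W`-divisibility
  `BigPrime.one_le_padicValRat_coeffW_of_slots` (slots `11n ≤ 12n ≤ 13n`: `p ≥ 16n + 1`, `p ≤ d + 1 = 25n + 1`) for `b(n)` and `b(n) + e_j`.
Results: **`recordRayQV`, `recordRayPhatV`** and the node restrictions `qMinorValuationLaw_on_bRec`, `phatMinorValuationLaw_on_bRec`.
Brute force (`g12/code/gap/minors_check.py 41,… 5`: n ≤ 5, every window prime, every j): 903 rows, 0 violations; (QV) attained 511×, (P̂V) 175×.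
MODEL/structure-side valuation bookkeeping of the cell's own rationals; the ∀-b nodes stay OPEN; nothing about ζ(5); no γ; records in print UNMOVED.
-/

open Finset

namespace Summit.KontsevichZagierPeriods.Zeta5Search.RecordRayMinors

open Summit.KontsevichZagierPeriods.Zeta5Search.ClusterValuation
open Summit.KontsevichZagierPeriods.Zeta5Search.CasoratianValuation (InPolytope shift casoratian pairFloors refund minorQ minorPhat)
open Summit.KontsevichZagierPeriods.Zeta5Search.WedgeDictionary (dOf coeffU coeffW coeffV)
open Summit.KontsevichZagierPeriods.Zeta5Search.PadicSeries (one_le_p zpow_p_nonneg)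
open Summit.KontsevichZagierPeriods.Zeta5Search.BigPrime (shift_zero dOf_shift)
open Summit.KontsevichZagierPeriods.Zeta5Search.RecordRayMid14 (refund_bRec_eq_one refund_bRec_eq_zero pairFloors_bRec_mid classExp_ge_neg5)
open Summit.KontsevichZagierPeriods.Zeta5Search.CellA (classExp_le_classNu bRec_zero)
open Summit.KontsevichZagierPeriods.Zeta5Search.ClusterValuation.MinorBounds

variable {p : ℕ} [hp : Fact p.Prime]

/-! ## §1 The `W`-divisibility unit on `18n < p ≤ 25n` -/

/-- `p ∣ W(c)` for a RECORD-LIKE vector `c` (`c₀ = 41n`; `c₁,…,c₄ ≥ 14n`; `c₅ ∈ [13n,13n+1]`; `c₆ ∈ [12n,12n+1]`) at `16n + 1 ≤ p ≤ d(c) + 1`. -/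
theorem coeffW_small_of_reclike {n : ℕ} (hn : 1 ≤ n) (hprime : p.Prime) (c : ℕ → ℤ) (hc : InPolytope c) (h0 : c 0 = 41 * n)
    (h5 : 13 * (n : ℤ) ≤ c 5 ∧ c 5 ≤ 13 * n + 1) (h6 : 12 * (n : ℤ) ≤ c 6 ∧ c 6 ≤ 12 * n + 1)
    (hbig : ∀ i ∈ range 4, 14 * (n : ℤ) ≤ c (i + 1)) (hp16 : 16 * n + 1 ≤ p) (hpd : (p : ℤ) ≤ dOf c + 1) :
    padicNorm p (coeffW c) ≤ (p : ℚ) ^ (-(1 : ℤ)) := by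
  refine padicNorm_le_of_val fun hW => ?_
  have hn1 : (1 : ℤ) ≤ n := by exact_mod_cast hn
  have hp' : (16 * n + 1 : ℤ) ≤ p := by exact_mod_cast hp16
  refine BigPrime.one_le_padicValRat_coeffW_of_slots c p 6 5 4 hc.1 hc.2.1 hc.2.2 (by simp) (by simp) (by simp) (by norm_num)
    (by linarith [h5.1, h6.2]) (fun k hk hk6 hk5 => ?_) hprime (by omega) (by rw [h0]; linarith [h5.1, h6.1]) hpd hW
  simp only [mem_range] at hk
  have hb0 := hbig 0 (by simp); have hb1 := hbig 1 (by simp); have hb2 := hbig 2 (by simp); have hb3 := hbig 3 (by simp)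
  simp only [Nat.reduceAdd] at hb0 hb1 hb2 hb3
  interval_cases k
  · linarith [h5.2]
  · linarith [h5.2]
  · linarith [h5.2]
  · linarith [h5.2]
  · exact le_rfl
  · exact absurd rfl hk5
  · exact absurd rfl hk6

/-- Every contiguous shift of the record ray (and the ray itself, `j = 0` excluded by `1 ≤ j` — see `reclike_bRec`) is record-like. -/
theorem reclike_shift {n j : ℕ} (hj1 : 1 ≤ j) (hj7 : j ≤ 7) : ((shift (bRec n) j) 0 = 41 * n) ∧
    (13 * (n : ℤ) ≤ (shift (bRec n) j) 5 ∧ (shift (bRec n) j) 5 ≤ 13 * n + 1) ∧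
    (12 * (n : ℤ) ≤ (shift (bRec n) j) 6 ∧ (shift (bRec n) j) 6 ≤ 12 * n + 1) ∧
    (∀ i ∈ range 4, 14 * (n : ℤ) ≤ (shift (bRec n) j) (i + 1)) := by
  interval_cases j <;>
  · refine ⟨?_, ?_, ?_, fun i hi => ?_⟩
    · simp [shift, bRec, Function.update]; ring
    · simp [shift, bRec, Function.update]; constructor <;> linarith
    · simp [shift, bRec, Function.update]; constructor <;> linarith
    · simp only [mem_range] at hi
      interval_cases i <;> simp [shift, bRec, Function.update] <;> linarith

/-- The record ray is record-like. -/
theorem reclike_bRec {n : ℕ} : ((bRec n) 0 = 41 * n) ∧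
    (13 * (n : ℤ) ≤ (bRec n) 5 ∧ (bRec n) 5 ≤ 13 * n + 1) ∧ (12 * (n : ℤ) ≤ (bRec n) 6 ∧ (bRec n) 6 ≤ 12 * n + 1) ∧
    (∀ i ∈ range 4, 14 * (n : ℤ) ≤ (bRec n) (i + 1)) := by
  refine ⟨by simp [bRec]; ring, by simp [bRec]; constructor <;> linarith, by simp [bRec]; constructor <;> linarith, fun i hi => ?_⟩
  simp only [mem_range] at hi
  interval_cases i <;> simp [bRec] <;> linarith

/-- **(QV)'s unit on `18n < p ≤ 25n`**: `v_p(minorQ_j(b(n))) ≥ 1` (`U`, `U⁺` `p`-integral: every multipole class has `E ≥ −2`; `p ∣ W`, `p ∣ W⁺`). -/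
theorem minorQ_unit {n j : ℕ} (hn : 1 ≤ n) (hj1 : 1 ≤ j) (hj7 : j ≤ 7) (hprime : p.Prime) (hA : 18 * n < p) (hB : p ≤ 25 * n)
    (hwin : (bRec n 0 + 2 : ℤ) < (p : ℤ) ^ 2) (hne : minorQ (bRec n) j ≠ 0) : (1 : ℤ) ≤ padicValRat p (minorQ (bRec n) j) := by
  have hp5 : 5 ≤ p := by omega
  have hb : InPolytope (bRec n) := inPolytope_bRec n
  have hb' : InPolytope (shift (bRec n) j) := inPolytope_shift_bRec n j hn hj1 hj7
  have h0' : shift (bRec n) j 0 = bRec n 0 := shift_zero _ hj1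
  have hwin' : (shift (bRec n) j 0 + 2 : ℤ) < (p : ℤ) ^ 2 := by rw [h0']; exact hwin
  have hum : ∀ x, x < p → 2 ≤ classPoleCount (bRec n) p x → (0 : ℤ) ≤ 5 + classExp (bRec n) p x :=
    fun x hx h2 => by have := (RecordRayTop.multipole_bound hn (by omega) (by omega) hx h2).2.2; omega
  have hcnt : ∀ x, classPoleCount (shift (bRec n) j) p x ≤ classPoleCount (bRec n) p x := fun x => classPoleCount_shift_le _ hb.1 hj1 p x
  have hum' : ∀ x, x < p → 2 ≤ classPoleCount (shift (bRec n) j) p x → (0 : ℤ) ≤ 5 + classExp (shift (bRec n) j) p x :=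
    fun x hx h2 => (hum x hx (le_trans h2 (hcnt x))).trans (by linarith [classExp_shift_ge _ hb.1 hj1 p x])
  have hU := coeffU_norm_le _ hb hp5 hwin 0 le_rfl hum
  have hU' := coeffU_norm_le _ hb' hp5 hwin' 0 le_rfl hum'
  obtain ⟨g0, g5, g6, gbig⟩ := reclike_bRec (n := n)
  obtain ⟨s0, s5, s6, sbig⟩ := reclike_shift (n := n) hj1 hj7
  have hW := coeffW_small_of_reclike hn hprime _ hb g0 g5 g6 gbig (by omega) (by rw [dOf_bRec]; omega)
  have hW' := coeffW_small_of_reclike hn hprime _ hb' s0 s5 s6 sbig (by omega) (by rw [dOf_shift _ hj1 hj7, dOf_bRec]; omega)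
  apply val_ge_of_padicNorm_le hne
  rw [minorQ, show (-(1 : ℤ)) = -((0 : ℤ) + 1) by norm_num]
  exact minor_norm_le hU hU' hW hW'

/-! ## §2 The record ray above `12n`, cell by cell -/

/-- Termwise step on the record ray: bounds `(u, w, v)` valid for the class data of `b(n)` at `p` give both minor bounds. -/
theorem rec_minors {n j : ℕ} (hn : 1 ≤ n) (hj1 : 1 ≤ j) (hj7 : j ≤ 7) (hp5 : 5 ≤ p) (hwin : (bRec n 0 + 2 : ℤ) < (p : ℤ) ^ 2)
    (u w v : ℤ) (hu0 : u ≤ 0) (hw0 : w ≤ 0)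
    (hum : ∀ x, x < p → 2 ≤ classPoleCount (bRec n) p x → u ≤ 5 + classExp (bRec n) p x)
    (hwm : ∀ x, x < p → 2 ≤ classPoleCount (bRec n) p x → w ≤ 3 + classExp (bRec n) p x)
    (hv : ∀ x, x < p → 1 ≤ classPoleCount (bRec n) p x → v ≤ classNu (bRec n) p x) :
    (minorQ (bRec n) j ≠ 0 → u + w ≤ padicValRat p (minorQ (bRec n) j)) ∧
    (minorPhat (bRec n) j ≠ 0 → u + v ≤ padicValRat p (minorPhat (bRec n) j)) :=
  minors_of_bounds _ (inPolytope_bRec n) hj1 (inPolytope_shift_bRec n j hn hj1 hj7) hp5 hwin u w v hu0 hw0 hum hwm hv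

/-- **(QV) and (P̂V) at every prime `p > 12n` on the record ray.** -/
theorem minors_gt12 {n j : ℕ} (hn : 1 ≤ n) (hj1 : 1 ≤ j) (hj7 : j ≤ 7) (hprime : p.Prime) (hwin : (bRec n 0 + 2 : ℤ) < (p : ℤ) ^ 2)
    (h12 : 12 * n < p) :
    (minorQ (bRec n) j ≠ 0 → refund (bRec n) p - pairFloors (bRec n) p ≤ padicValRat p (minorQ (bRec n) j)) ∧
    (minorPhat (bRec n) j ≠ 0 → refund (bRec n) p - 1 - pairFloors (bRec n) p ≤ padicValRat p (minorPhat (bRec n) j)) := by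
  have hp0 : 0 < p := hprime.pos
  have hp5 : 5 ≤ p := by omega
  by_cases h41 : 41 * n < p
  · have hpb : (bRec n) 0 + 1 ≤ (p : ℤ) := by rw [bRec_zero]; omega
    exact ⟨fun hne => BigPrime.qMinorValuationLaw_above _ j p (inPolytope_bRec n) hj1 hj7 (inPolytope_shift_bRec n j hn hj1 hj7) hprime hp5 hpb hne,
      fun hne => BigPrime.phatMinorValuationLaw_above _ j p (inPolytope_bRec n) hj1 (inPolytope_shift_bRec n j hn hj1 hj7) hprime hpb hne⟩
  push Not at h41
  by_cases h14 : p < 14 * n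
  · have hc := rec_minors hn hj1 hj7 hp5 hwin 0 (-2) (-5) le_rfl (by norm_num)
      (fun x hx _ => by have := classExp_ge_neg5 h12 h14 hx; omega) (fun x hx _ => by have := classExp_ge_neg5 h12 h14 hx; omega)
      (fun x hx _ => (classExp_ge_neg5 h12 h14 hx).trans (classExp_le_classNu _ p x))
    rw [refund_bRec_eq_one hp0 (by omega), pairFloors_bRec_mid h12]
    exact ⟨fun hne => by have := hc.1 hne; split_ifs <;> omega, fun hne => by have := hc.2 hne; split_ifs <;> omega⟩
  have h14' : 14 * n < p := lt_of_le_of_ne (by omega) (prime_ne_mul hprime hp5 (Or.inl rfl)).symm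
  by_cases h15 : p < 15 * n
  · have hE : ∀ x, x < p → 1 ≤ classPoleCount (bRec n) p x → (-4 : ℤ) ≤ classNu (bRec n) p x ∧
        (2 ≤ classPoleCount (bRec n) p x → (-4 : ℤ) ≤ classExp (bRec n) p x) := by
      intro x hx _
      by_cases hm : x ∈ CellA.MinAll n p
      · obtain ⟨-, hE, -⟩ := CellA.data_minAll hn h14' h15 hprime hm
        exact ⟨by have := classExp_le_classNu (bRec n) p x; omega, fun _ => by omega⟩
      · obtain ⟨hν, hm2⟩ := CellA.notMin_bounds hn h14' h15 hprime hx hm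
        exact ⟨by omega, fun h2 => by have := hm2 h2; omega⟩
    have hc := rec_minors hn hj1 hj7 hp5 hwin 0 (-1) (-4) le_rfl (by norm_num)
      (fun x hx h2 => by have := (hE x hx (by omega)).2 h2; omega) (fun x hx h2 => by have := (hE x hx (by omega)).2 h2; omega)
      (fun x hx h1 => (hE x hx h1).1)
    rw [refund_bRec_eq_one hp0 (by omega), pairFloors_bRec_mid h12]
    exact ⟨fun hne => by have := hc.1 hne; split_ifs <;> omega, fun hne => by have := hc.2 hne; split_ifs <;> omega⟩
  have h15' : 15 * n < p := lt_of_le_of_ne (by omega) (prime_ne_mul hprime hp5 (Or.inr (Or.inl rfl))).symm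
  by_cases h16 : p < 16 * n
  · have hc := rec_minors hn hj1 hj7 hp5 hwin 0 0 (-3) le_rfl le_rfl
      (fun x hx h2 => by have := Cell1516.classExp_ge16 hn h15' h16 hx h2; omega)
      (fun x hx h2 => by have := Cell1516.classExp_ge16 hn h15' h16 hx h2; omega)
      (fun x hx h1 => Cell1516.classNu_ge16 hn h15' h16 hx h1)
    rw [refund_bRec_eq_one hp0 (by omega), pairFloors_bRec_mid h12]
    exact ⟨fun hne => by have := hc.1 hne; split_ifs <;> omega, fun hne => by have := hc.2 hne; split_ifs <;> omega⟩
  have h16' : 16 * n < p := lt_of_le_of_ne (by omega) (prime_ne_mul hprime hp5 (Or.inr (Or.inr rfl))).symm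
  -- `p > 16n`: multipole `E ≥ −2`, `ν ≥ −2 / −1 / 0`
  have hM : ∀ x, x < p → 2 ≤ classPoleCount (bRec n) p x → (-2 : ℤ) ≤ classExp (bRec n) p x :=
    fun x hx h2 => (RecordRayTop.multipole_bound hn h16' h41 hx h2).2.2
  have hN := fun x (hx : x < p) (h1 : 1 ≤ classPoleCount (bRec n) p x) => RecordRayTop.classNu_bound hn h16' h41 hx h1
  rw [pairFloors_bRec_mid h12]
  by_cases h17 : p ≤ 17 * n
  · have hc := rec_minors hn hj1 hj7 hp5 hwin 0 0 (-2) le_rfl le_rfl (fun x hx h2 => by have := hM x hx h2; omega)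
      (fun x hx h2 => by have := hM x hx h2; omega) (fun x hx h1 => (hN x hx h1).1)
    rw [refund_bRec_eq_one hp0 (by omega)]
    exact ⟨fun hne => by have := hc.1 hne; split_ifs <;> omega, fun hne => by have := hc.2 hne; split_ifs <;> omega⟩
  by_cases h18 : p ≤ 18 * n
  · have hc := rec_minors hn hj1 hj7 hp5 hwin 0 0 (-1) le_rfl le_rfl (fun x hx h2 => by have := hM x hx h2; omega)
      (fun x hx h2 => by have := hM x hx h2; omega) (fun x hx h1 => (hN x hx h1).2.1 (by omega))
    rw [refund_bRec_eq_one hp0 (by omega)]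
    exact ⟨fun hne => by have := hc.1 hne; split_ifs <;> omega, fun hne => by have := hc.2 hne; split_ifs <;> omega⟩
  have hc := rec_minors hn hj1 hj7 hp5 hwin 0 0 0 le_rfl le_rfl (fun x hx h2 => by have := hM x hx h2; omega)
    (fun x hx h2 => by have := hM x hx h2; omega) (fun x hx h1 => (hN x hx h1).2.2 (by omega))
  by_cases h25 : p ≤ 25 * n
  · rw [refund_bRec_eq_one hp0 h25]
    exact ⟨fun hne => by have := minorQ_unit hn hj1 hj7 hprime (by omega) h25 hwin hne; split_ifs <;> omega,
      fun hne => by have := hc.2 hne; split_ifs <;> omega⟩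
  · rw [refund_bRec_eq_zero (by omega)]
    exact ⟨fun hne => by have := hc.1 hne; split_ifs <;> omega, fun hne => by have := hc.2 hne; split_ifs <;> omega⟩

/-! ## §3 The low range `p ≤ 12n` by counting -/

/-- **(QV) and (P̂V) on `173n < 35p`, `p ≤ 12n`** from the interval certificate `rrd_table` (its margin dominates both minor laws). -/
theorem minors_mid (n j p : ℕ) (hn : 1 ≤ n) (hj1 : 1 ≤ j) (hj7 : j ≤ 7) (hprime : p.Prime) (hp5 : 5 ≤ p)
    (hwin : (bRec n 0 + 2 : ℤ) < (p : ℤ) ^ 2) (hlo : 173 * n < 35 * p) (hhi : p ≤ 12 * n) :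
    (minorQ (bRec n) j ≠ 0 → refund (bRec n) p - pairFloors (bRec n) p ≤ padicValRat p (minorQ (bRec n) j)) ∧
    (minorPhat (bRec n) j ≠ 0 → refund (bRec n) p - 1 - pairFloors (bRec n) p ≤ padicValRat p (minorPhat (bRec n) j)) := by
  haveI : Fact p.Prime := ⟨hprime⟩
  have hp : 0 < p := hprime.pos
  have hn0 : 0 < n := by omega
  have hb := inPolytope_bRec n
  set s := (2520 * p + n - 1) / n with hsdef
  have hs1 : 2520 * p ≤ s * n := by
    have h := Nat.lt_div_mul_add (a := 2520 * p + n - 1) hn0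
    rw [← hsdef] at h
    omega
  have hs2 : s * n < 2520 * p + n := by
    have h := Nat.div_mul_le_self (2520 * p + n - 1) n
    rw [← hsdef] at h
    omega
  have hslo : 12457 ≤ s := by
    by_contra h
    push Not at h
    have : s * n ≤ 12456 * n := Nat.mul_le_mul_right n (by omega)
    omega
  have hshi : s ≤ 30240 := by
    by_contra h
    push Not at h
    have : 30241 * n ≤ s * n := Nat.mul_le_mul_right n (by omega)
    omega
  have hs1' : 2520 * p ≤ n * s := by rw [Nat.mul_comm n s]; exact hs1
  have hs2' : n * s < 2520 * p + n := by rw [Nat.mul_comm n s]; exact hs2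
  have hT : ∀ c : ℕ, c ≤ 41 → ((c : ℤ) * n) / (p : ℤ) = ((2520 * c / s : ℕ) : ℤ) := by
    intro c hc
    have hcn : c * n < 10 * p := by
      have : c * n ≤ 41 * n := Nat.mul_le_mul_right n hc
      omega
    rw [← natFloor_transfer hp hs1' hs2' hcn, Int.natCast_div]
    push_cast
    rfl
  have hz : ∀ (a b : ℤ) (c : ℕ), (41 : ℤ) - a - b = c → c ≤ 41 →
      ((n : ℤ) * 41 - (n : ℤ) * a - (n : ℤ) * b) / (p : ℤ) = ((2520 * c / s : ℕ) : ℤ) := by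
    intro a b c h hc
    rw [show (n : ℤ) * 41 - (n : ℤ) * a - (n : ℤ) * b = (c : ℤ) * n by rw [← h]; ring]
    exact hT c hc
  have hw : ∀ (a : ℤ) (c : ℕ), (41 : ℤ) - 2 * a = c → c ≤ 41 →
      ((n : ℤ) * 41 - 2 * ((n : ℤ) * a)) / (p : ℤ) = ((2520 * c / s : ℕ) : ℤ) := by
    intro a c h hc
    rw [show (n : ℤ) * 41 - 2 * ((n : ℤ) * a) = (c : ℤ) * n by rw [← h]; ring]
    exact hT c hc
  have h41 : (n : ℤ) * 41 / (p : ℤ) = ((2520 * 41 / s : ℕ) : ℤ) := by rw [mul_comm]; exact hT 41 le_rfl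
  have h25 : (25 : ℤ) * n / (p : ℤ) = ((2520 * 25 / s : ℕ) : ℤ) := hT 25 (by norm_num)
  obtain ⟨hmargin, hN1⟩ := rrd_table hslo hshi
  set L : ℤ := (((2520 * 41 / s : ℕ) : ℤ) - ((((2520 * 7 / s : ℕ) : ℤ) + 1) + (((2520 * 9 / s : ℕ) : ℤ) + 1) + (((2520 * 11 / s : ℕ) : ℤ) + 1) +
    (((2520 * 13 / s : ℕ) : ℤ) + 1) + (((2520 * 15 / s : ℕ) : ℤ) + 1) + (((2520 * 17 / s : ℕ) : ℤ) + 1) + (((2520 * 19 / s : ℕ) :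
    ℤ) + 1))) with hLdef
  set N : ℤ := (((2520 * 8 / s : ℕ) : ℤ) + ((2520 * 9 / s : ℕ) : ℤ) + ((2520 * 10 / s : ℕ) : ℤ) + ((2520 * 11 / s : ℕ) : ℤ) + ((2520 * 12 / s :
    ℕ) : ℤ) + ((2520 * 13 / s : ℕ) : ℤ) + ((2520 * 10 / s : ℕ) : ℤ) + ((2520 * 11 / s : ℕ) : ℤ) + ((2520 * 12 / s : ℕ) : ℤ) +
    ((2520 * 13 / s : ℕ) : ℤ) + ((2520 * 14 / s : ℕ) : ℤ) + ((2520 * 12 / s : ℕ) : ℤ) + ((2520 * 13 / s : ℕ) : ℤ) + ((2520 * 14 /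
    s : ℕ) : ℤ) + ((2520 * 15 / s : ℕ) : ℤ) + ((2520 * 14 / s : ℕ) : ℤ) + ((2520 * 15 / s : ℕ) : ℤ) + ((2520 * 16 / s : ℕ) : ℤ) +
    ((2520 * 16 / s : ℕ) : ℤ) + ((2520 * 17 / s : ℕ) : ℤ) + ((2520 * 18 / s : ℕ) : ℤ)) with hNdef
  have hN : pairFloors (bRec n) p = N := by
    unfold pairFloors
    conv_lhs => simp only [sum_range_succ, sum_range_zero, bRec]; norm_num
    rw [hz 17 16 8 (by norm_num) (by norm_num), hz 17 15 9 (by norm_num) (by norm_num), hz 17 14 10 (by norm_num) (by norm_num),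
      hz 17 13 11 (by norm_num) (by norm_num), hz 17 12 12 (by norm_num) (by norm_num), hz 17 11 13 (by norm_num) (by norm_num),
      hz 16 15 10 (by norm_num) (by norm_num), hz 16 14 11 (by norm_num) (by norm_num), hz 16 13 12 (by norm_num) (by norm_num),
      hz 16 12 13 (by norm_num) (by norm_num), hz 16 11 14 (by norm_num) (by norm_num), hz 15 14 12 (by norm_num) (by norm_num),
      hz 15 13 13 (by norm_num) (by norm_num), hz 15 12 14 (by norm_num) (by norm_num), hz 15 11 15 (by norm_num) (by norm_num),
      hz 14 13 14 (by norm_num) (by norm_num), hz 14 12 15 (by norm_num) (by norm_num), hz 14 11 16 (by norm_num) (by norm_num),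
      hz 13 12 16 (by norm_num) (by norm_num), hz 13 11 17 (by norm_num) (by norm_num), hz 12 11 18 (by norm_num) (by norm_num)]
    rw [hNdef]; ring
  have hL : (bRec n 0) / (p : ℤ) - ∑ j ∈ range 7, ((bRec n 0 - 2 * bRec n (j + 1)) / (p : ℤ) + 1) = L := by
    conv_lhs => simp only [sum_range_succ, sum_range_zero, bRec]; norm_num
    rw [h41, hw 17 7 (by norm_num) (by norm_num), hw 16 9 (by norm_num) (by norm_num), hw 15 11 (by norm_num) (by norm_num),
      hw 14 13 (by norm_num) (by norm_num), hw 13 15 (by norm_num) (by norm_num), hw 12 17 (by norm_num) (by norm_num),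
      hw 11 19 (by norm_num) (by norm_num)]
  have hR : refund (bRec n) p = min 1 ((2520 * 25 / s : ℕ) : ℤ) := by
    unfold refund
    rw [dOf_bRec, h25]
  have hEL : ∀ x, x < p → L ≤ classExp (bRec n) p x := fun x hx => hL ▸ classExp_ge_count _ hb hp hx
  have hmb := minors_of_bounds (bRec n) hb hj1 (inPolytope_shift_bRec n j hn hj1 hj7) hp5 hwin (min 0 (5 + L)) (min 0 (3 + L)) L
    (min_le_left _ _) (min_le_left _ _) (fun x hx _ => by have := hEL x hx; have := min_le_right (0:ℤ) (5 + L); omega)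
    (fun x hx _ => by have := hEL x hx; have := min_le_right (0:ℤ) (3 + L); omega)
    (fun x hx _ => (hEL x hx).trans (classExp_le_classNu _ p x))
  rw [hR, hN]
  refine ⟨fun hne => le_trans ?_ (hmb.1 hne), fun hne => le_trans ?_ (hmb.2 hne)⟩
  · have := min_le_left (1 : ℤ) ((2520 * 25 / s : ℕ) : ℤ)
    rcases le_or_gt L 0 with hL0 | hL0
    · have h1 : min (0:ℤ) (5 + L) + min 0 (3 + L) ≥ L + min 0 (3 + L) := by
        rcases le_or_gt (5 + L) 0 with h5 | h5
        · rw [min_eq_right h5]; linarith [min_le_right (0:ℤ) (3+L)]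
        · rw [min_eq_left h5.le]; linarith
      linarith
    · rw [min_eq_left (by linarith : (0:ℤ) ≤ 5 + L), min_eq_left (by linarith : (0:ℤ) ≤ 3 + L)]
      linarith
  · have := min_le_left (1 : ℤ) ((2520 * 25 / s : ℕ) : ℤ)
    have h1 : min (0:ℤ) (5 + L) + L ≥ L + min 0 (3 + L) := by
      rcases le_or_gt (5 + L) 0 with h5 | h5
      · rw [min_eq_right h5, min_eq_right (by linarith : (3:ℤ) + L ≤ 0)]; linarith
      · rw [min_eq_left h5.le]; linarith [min_le_left (0:ℤ) (3 + L)]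
    linarith

/-- **(QV) and (P̂V) on `35p ≤ 173n + 23`** by the tree's linear counts (`2L + N_p ≥ −5`, `L + N_p ≥ 1`, `N_p ≥ 1`). -/
theorem minors_small (n j p : ℕ) (hn : 1 ≤ n) (hj1 : 1 ≤ j) (hj7 : j ≤ 7) (hprime : p.Prime) (hp5 : 5 ≤ p)
    (hwin : (bRec n 0 + 2 : ℤ) < (p : ℤ) ^ 2) (hsmall : 35 * p ≤ 173 * n + 23) :
    (minorQ (bRec n) j ≠ 0 → refund (bRec n) p - pairFloors (bRec n) p ≤ padicValRat p (minorQ (bRec n) j)) ∧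
    (minorPhat (bRec n) j ≠ 0 → refund (bRec n) p - 1 - pairFloors (bRec n) p ≤ padicValRat p (minorPhat (bRec n) j)) := by
  haveI : Fact p.Prime := ⟨hprime⟩
  have hp : 0 < p := hprime.pos
  have hpZ : (0 : ℤ) < p := by exact_mod_cast hp
  have hb := inPolytope_bRec n
  set L : ℤ := (bRec n) 0 / (p : ℤ) - ∑ j ∈ range 7, (((bRec n) 0 - 2 * (bRec n) (j + 1)) / (p : ℤ) + 1) with hLdef
  set N : ℤ := pairFloors (bRec n) p with hNdef
  have hcL := mul_countBound_ge (bRec n) hp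
  have hcN := mul_pairFloors_ge (bRec n) hp
  rw [← hLdef, dOf_bRec] at hcL
  rw [← hNdef, dOf_bRec, bRec_zero] at hcN
  have hsm : (35 * p : ℤ) ≤ 173 * n + 23 := by exact_mod_cast hsmall
  have h1 : -5 ≤ 2 * L + N := by
    by_contra hc; push Not at hc
    have h : (p : ℤ) * (2 * L + N) ≤ (p : ℤ) * (-6) := mul_le_mul_of_nonneg_left (by omega) hpZ.le
    have e : (p : ℤ) * (2 * L + N) = 2 * ((p : ℤ) * L) + (p : ℤ) * N := by ring
    rw [e] at h
    linarith
  have h2 : 1 ≤ L + N := by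
    by_contra hc; push Not at hc
    have h : (p : ℤ) * (L + N) ≤ (p : ℤ) * 0 := mul_le_mul_of_nonneg_left (by omega) hpZ.le
    have e : (p : ℤ) * (L + N) = (p : ℤ) * L + (p : ℤ) * N := by ring
    rw [e] at h
    linarith
  have h3 : 1 ≤ N := by
    by_contra hc; push Not at hc
    have h : (p : ℤ) * N ≤ (p : ℤ) * 0 := mul_le_mul_of_nonneg_left (by omega) hpZ.le
    linarith
  have hEL : ∀ x, x < p → L ≤ classExp (bRec n) p x := fun x hx => classExp_ge_count _ hb hp hx
  have hmb := minors_of_bounds (bRec n) hb hj1 (inPolytope_shift_bRec n j hn hj1 hj7) hp5 hwin (min 0 (5 + L)) (min 0 (3 + L)) L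
    (min_le_left _ _) (min_le_left _ _) (fun x hx _ => by have := hEL x hx; have := min_le_right (0:ℤ) (5 + L); omega)
    (fun x hx _ => by have := hEL x hx; have := min_le_right (0:ℤ) (3 + L); omega)
    (fun x hx _ => (hEL x hx).trans (classExp_le_classNu _ p x))
  have hr : refund (bRec n) p ≤ 1 := min_le_left _ _
  refine ⟨fun hne => le_trans ?_ (hmb.1 hne), fun hne => le_trans ?_ (hmb.2 hne)⟩
  · rcases le_or_gt (5 + L) 0 with h5 | h5
    · rw [min_eq_right h5, min_eq_right (by linarith : (3:ℤ) + L ≤ 0)]; linarith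
    · rw [min_eq_left h5.le]
      rcases le_or_gt (3 + L) 0 with h3' | h3'
      · rw [min_eq_right h3']; linarith
      · rw [min_eq_left h3'.le]; linarith
  · rcases le_or_gt (5 + L) 0 with h5 | h5
    · rw [min_eq_right h5]; linarith
    · rw [min_eq_left h5.le]; linarith

/-! ## §4 (QV) and (P̂V) on the whole record ray -/

/-- **(QV) ON THE WHOLE RECORD RAY, every direction `j`, all `n`**: for `n ≥ 1`, `1 ≤ j ≤ 7`, every prime `p ≥ 5` with `p² > 41n + 2` and
`minorQ_j(b(n)) ≠ 0`: `refund − N_p ≤ v_p(U(b)W(b+e_j) − U(b+e_j)W(b))`. -/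
theorem recordRayQV (n j p : ℕ) (hn : 1 ≤ n) (hj1 : 1 ≤ j) (hj7 : j ≤ 7) (hprime : p.Prime) (hp5 : 5 ≤ p)
    (hwin : (41 * n + 2 : ℤ) < (p : ℤ) ^ 2) (hne : minorQ (bRec n) j ≠ 0) :
    refund (bRec n) p - pairFloors (bRec n) p ≤ padicValRat p (minorQ (bRec n) j) := by
  haveI : Fact p.Prime := ⟨hprime⟩
  have hwin' : (bRec n 0 + 2 : ℤ) < (p : ℤ) ^ 2 := by rw [bRec_zero]; linarith
  by_cases h12 : 12 * n < p
  · exact (minors_gt12 hn hj1 hj7 hprime hwin' h12).1 hne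
  push Not at h12
  by_cases hlo : 173 * n < 35 * p
  · exact (minors_mid n j p hn hj1 hj7 hprime hp5 hwin' hlo h12).1 hne
  · exact (minors_small n j p hn hj1 hj7 hprime hp5 hwin' (by omega)).1 hne

/-- **(P̂V) ON THE WHOLE RECORD RAY, every direction `j`, all `n`**: `refund − 1 − N_p ≤ v_p(U(b)V(b+e_j) − U(b+e_j)V(b))`. -/
theorem recordRayPhatV (n j p : ℕ) (hn : 1 ≤ n) (hj1 : 1 ≤ j) (hj7 : j ≤ 7) (hprime : p.Prime) (hp5 : 5 ≤ p)
    (hwin : (41 * n + 2 : ℤ) < (p : ℤ) ^ 2) (hne : minorPhat (bRec n) j ≠ 0) :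
    refund (bRec n) p - 1 - pairFloors (bRec n) p ≤ padicValRat p (minorPhat (bRec n) j) := by
  haveI : Fact p.Prime := ⟨hprime⟩
  have hwin' : (bRec n 0 + 2 : ℤ) < (p : ℤ) ^ 2 := by rw [bRec_zero]; linarith
  by_cases h12 : 12 * n < p
  · exact (minors_gt12 hn hj1 hj7 hprime hwin' h12).2 hne
  push Not at h12
  by_cases hlo : 173 * n < 35 * p
  · exact (minors_mid n j p hn hj1 hj7 hprime hp5 hwin' hlo h12).2 hne
  · exact (minors_small n j p hn hj1 hj7 hprime hp5 hwin' (by omega)).2 hne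

/-- **The node `QMinorValuationLaw` restricted to the record ray**, binders verbatim with `b := b(n)`, plus the window `p² > b₀ + 2`. -/
theorem qMinorValuationLaw_on_bRec (n j p : ℕ) (hn : 1 ≤ n) (hwin : (bRec n 0 + 2 : ℤ) < (p : ℤ) ^ 2) :
    InPolytope (bRec n) → 1 ≤ j → j ≤ 7 → InPolytope (shift (bRec n) j) → p.Prime → 5 ≤ p → minorQ (bRec n) j ≠ 0 →
      refund (bRec n) p - pairFloors (bRec n) p ≤ padicValRat p (minorQ (bRec n) j) := by
  intro _ hj1 hj7 _ hprime hp5 hne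
  rw [bRec_zero] at hwin
  exact recordRayQV n j p hn hj1 hj7 hprime hp5 (by linarith) hne

/-- **The node `PhatMinorValuationLaw` restricted to the record ray**, binders verbatim with `b := b(n)`. -/
theorem phatMinorValuationLaw_on_bRec (n j p : ℕ) (hn : 1 ≤ n) :
    InPolytope (bRec n) → 1 ≤ j → j ≤ 7 → InPolytope (shift (bRec n) j) → p.Prime → 5 ≤ p →
    (bRec n 0 + 2 : ℤ) < (p : ℤ) ^ 2 → minorPhat (bRec n) j ≠ 0 →
      refund (bRec n) p - 1 - pairFloors (bRec n) p ≤ padicValRat p (minorPhat (bRec n) j) := by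
  intro _ hj1 hj7 _ hprime hp5 hwin hne
  rw [bRec_zero] at hwin
  exact recordRayPhatV n j p hn hj1 hj7 hprime hp5 (by linarith) hne

end Summit.KontsevichZagierPeriods.Zeta5Search.RecordRayMinors
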